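import Literature.MathematicalPhysics.QuantumFieldTheory.GaugeOSData
import Summits.QuantumFields.YangMills.Theorems.EquipartitionCriticalityCriticalContinuumLimitStubThetaCorrRPTorus
import Summits.QuantumFields.YangMills.Theorems.EquipartitionCriticalityRPProbeCriticalityOddLimit
import HarnessLib

/-!
# `CriticalContinuumLimit` — line `Sketch`, stub `stub_thetaCorrRP`, part 2/2: the `Θ`-paired
# curvature correlator of the odd torus is non-negative and log-convex (T-Hankel)

Support file for crux `stmt-QuantumFields-8762`
(`Summit.QuantumFields.YangMills.Theses.EquipartitionCriticality.CriticalContinuumLimit`): this is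
stub `stub_thetaCorrRP` (torus input (T-Hankel)) of line `Sketch`
(skeleton `Cruxes/CriticalContinuumLimit/Lines/Sketch.lean`); part 1
(`EquipartitionCriticalityCriticalContinuumLimitStubThetaCorrRPTorus.lean`) is the torus layer.

**Statement.** For a lattice representation `r` of the compact group `G`, `β ≥ 0` and a separation
`n`, on all large odd tori `(ℤ/(2S+1)ℤ)⁴` the `Θ`-paired curvature correlator
`a_S(n) = latticeConnectedCorr r.ρ β (2S+1) (P ∘ Θ) P n`, `P = r.curvature.F = actionDensity r.ρ`
(the six plaquettes at the origin of `ℤ⁴`), `Θ = gaugeTimeReflect` (bond reflection `x₀ ↦ -1-x₀`),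
satisfies `0 ≤ a_S(n)` and `a_S(n+1)² ≤ a_S(n) a_S(n+2)`.

**Proof.** *Bridge* (`latticeConnectedCorr_theta`): on periodic configurations `P ∘ τ_{-ne₀} ∘ lift`
is the slab action density `Q_n` of the torus at the axial site `n e₀` (tree `configShift_torusLift`,
`plaquette_torusLift`), and `P ∘ Θ ∘ lift = Q_2 ∘ Θ_T` with Wave 0's torus reflection
`Θ_T = GaugeConfig.timeReflect`, `θ_T t = 1 - t` (tree `gaugeTimeReflect_torusLift`:
`Θ ∘ lift = lift ∘ T_{-2e₀} ∘ Θ_T`); the torus state is translation invariant, so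
`a_S(n) = Cov(Q_2 ∘ Θ_T, Q_n) =: c(2, n)`. *Torus layer* (part 1, `stub_thetaCorrRP_torus`):
`c(a, b) = c(a+t, b-t)` and the two Cauchy–Schwarz families of Osterwalder–Seiler positivity for the
mixed reflection of the odd torus, `0 ≤ c(s,s)`, `c(s,s')² ≤ c(s,s)c(s',s')` and `0 ≤ c(-s,-s)`,
`c(-s',-s)² ≤ c(-s,-s)c(-s',-s')`, `1 ≤ s, s' ≤ S`. *Indices* (`S ≥ n + 3`): for even `n = 2i`
take `s = i+1`, `s' = i+2` (`c(2,2i) = c(i+1,i+1)`, `c(2,2i+1) = c(i+1,i+2)`, `c(2,2i+2) = c(i+2,i+2)`);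
for odd `n = 2i+1` take `s = S-1-i`, `s' = S-2-i` and use the period `2S+1 ≡ 0`
(`c(2,2i+1) = c(-s,-s)`, `c(2,2i+2) = c(-s',-s)`, `c(2,2i+3) = c(-s',-s')`).

References: K. Osterwalder, E. Seiler, Ann. Phys. 110 (1978) 440, §2; E. Seiler, LNP 159 (1982)
Ch. 2; J. Glimm, A. Jaffe, *Quantum Physics* (1987) §6.1.
-/

noncomputable section

open MeasureTheory Filter Topology ProbabilityTheory
open Literature.MathematicalPhysics.AQFT Literature.MathematicalPhysics.QuantumLattice
open Literature.MathematicalPhysics.QuantumFieldTheory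

namespace Summit.QuantumFields.YangMills.Theorems.CriticalContinuumLimit

/-! ### Bridge: the `ℤ⁴` action density on periodic configurations -/

section Bridge

variable {G : Type} [Group G] {N : ℕ} (ρ : G →* Matrix (Fin N) (Fin N) ℂ)

omit [Group G] in
/-- The sum over the six coordinate planes `i < j` as a sum over the subtype of planes. [folklore] -/
theorem sum_planes (f : Fin 4 × Fin 4 → ℝ) :
    ∑ q : {p : Fin 4 × Fin 4 // p.1 < p.2}, f q.1 =
      ∑ i : Fin 4, ∑ j : Fin 4, if i < j then f (i, j) else 0 := by
  rw [← Finset.sum_subtype (Finset.univ.filter fun p : Fin 4 × Fin 4 => p.1 < p.2) (by simp) f,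
    Finset.sum_filter, Fintype.sum_prod_type]

/-- **The action density of a periodic configuration is the slab density of the torus at the
origin**: `P(lift V) = Σ_q Re tr ρ(V_{(0,q)})` (tree `plaquette_torusLift`). [folklore] -/
theorem actionDensity_torusLift_eq_sdens (L : ℕ) (V : GaugeConfig 4 L G) :
    actionDensity ρ (torusLift L V) =
      ∑ q : {p : Fin 4 × Fin 4 // p.1 < p.2}, WilsonRP.plaqRe ρ V (0, q) := by
  have h : ∀ i j : Fin 4, plaquetteHolonomyZd (torusLift L V) 0 i j = plaquetteHolonomy V 0 i j :=
    fun i j => (plaquette_torusLift L V 0 i j).trans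
      (by rw [EquipartitionCriticality.RPProbe.torusProj_zero])
  have hs := sum_planes (fun p : Fin 4 × Fin 4 => (ρ (plaquetteHolonomy V 0 p.1 p.2)).trace.re)
  simp only at hs
  simp only [actionDensity, plaquetteObs, h, WilsonRP.plaqRe]
  exact hs.symm

variable [MeasurableSpace G]

/-- **The translated action density on periodic configurations is the axial slab density**:
`P(τ_{-ne₀} lift U) = Q_{n e₀}(U)` (tree `configShift_torusLift`). [folklore] -/
theorem actionDensity_configShift_torusLift (L n : ℕ) (U : GaugeConfig 4 L G) :
    actionDensity ρ (configShift (-Pi.single 0 (n : ℤ)) (torusLift L U)) =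
      ∑ q : {p : Fin 4 × Fin 4 // p.1 < p.2},
        WilsonRP.plaqRe ρ U ((Pi.single 0 ((n : ℕ) : ZMod L) : Site 4 L), q) := by
  rw [EquipartitionCriticality.RPProbe.configShift_torusLift, actionDensity_torusLift_eq_sdens,
    ThetaCorrRP.sdens_torusConfigShift, EquipartitionCriticality.RPProbe.torusProj_neg,
    EquipartitionCriticality.RPProbe.torusProj_single_zero, zero_sub, neg_neg]

/-- **The reflected action density on periodic configurations**: `P(Θ lift U) = Q_{2e₀}(Θ_T U)`
(tree `gaugeTimeReflect_torusLift`: `Θ ∘ lift = lift ∘ T_{-2e₀} ∘ Θ_T`). [folklore] -/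
theorem actionDensity_gaugeTimeReflect_torusLift (L : ℕ) (U : GaugeConfig 4 L G) :
    actionDensity ρ (gaugeTimeReflect (torusLift L U)) =
      ∑ q : {p : Fin 4 × Fin 4 // p.1 < p.2},
        WilsonRP.plaqRe ρ (GaugeConfig.timeReflect U) ((Pi.single 0 (2 : ZMod L) : Site 4 L), q) := by
  rw [ClusteringToYangMills.Reconstructible.gaugeTimeReflect_torusLift, actionDensity_torusLift_eq_sdens,
    ThetaCorrRP.sdens_torusConfigShift, zero_sub, ← Pi.single_neg, neg_neg]

variable [TopologicalSpace G] [IsTopologicalGroup G] [CompactSpace G] [BorelSpace G]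

/-- **Translation invariance of the mean slab density**: `⟨Q_{c e₀}⟩ = ⟨Q_0⟩`
(`wilsonExpectation_comp_torusConfigShift`). [folklore] -/
theorem integral_sdens_axis (β : ℝ) {L : ℕ} [NeZero L] (c : ZMod L) :
    ∫ U, ∑ q : {p : Fin 4 × Fin 4 // p.1 < p.2},
        WilsonRP.plaqRe ρ U ((Pi.single 0 c : Site 4 L), q) ∂(wilsonMeasure (d := 4) (L := L) ρ β) =
      ∫ U, ∑ q : {p : Fin 4 × Fin 4 // p.1 < p.2},
        WilsonRP.plaqRe ρ U (0, q) ∂(wilsonMeasure (d := 4) (L := L) ρ β) := by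
  have h := wilsonExpectation_comp_torusConfigShift (d := 4) ρ β (-(Pi.single 0 c : Site 4 L))
    (fun U => ∑ q : {p : Fin 4 × Fin 4 // p.1 < p.2}, WilsonRP.plaqRe ρ U (0, q))
  simp only [wilsonExpectation, Function.comp_apply, ThetaCorrRP.sdens_torusConfigShift, zero_sub,
    neg_neg] at h
  exact h

/-- **Bridge.** The `Θ`-paired curvature correlator of the torus of side `2S+1` is the reflected
covariance of the slab action density: `latticeConnectedCorr ρ β (2S+1) (P∘Θ) P n = Cov(Q_2∘Θ_T, Q_n)`
(`P = actionDensity ρ`, `Θ = gaugeTimeReflect`, `Θ_T = GaugeConfig.timeReflect`). [folklore] -/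
theorem latticeConnectedCorr_theta (hρ : Continuous ρ) (β : ℝ) (S n : ℕ) :
    latticeConnectedCorr ρ β (2 * S + 1) (actionDensity ρ ∘ gaugeTimeReflect) (actionDensity ρ) n =
      cov[fun U => ∑ q : {p : Fin 4 × Fin 4 // p.1 < p.2},
          WilsonRP.plaqRe ρ (GaugeConfig.timeReflect U)
            ((Pi.single 0 (2 : ZMod (2 * S + 1)) : Site 4 (2 * S + 1)), q),
        fun U => ∑ q : {p : Fin 4 × Fin 4 // p.1 < p.2},
          WilsonRP.plaqRe ρ U ((Pi.single 0 ((n : ℕ) : ZMod (2 * S + 1)) : Site 4 (2 * S + 1)), q);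
        wilsonMeasure (d := 4) (L := 2 * S + 1) ρ β] := by
  haveI := isProbabilityMeasure_wilsonMeasure (d := 4) (L := 2 * S + 1) ρ hρ β
  have hLp : ∀ x : Site 4 (2 * S + 1), MemLp (fun U : GaugeConfig 4 (2 * S + 1) G =>
      ∑ q : {p : Fin 4 × Fin 4 // p.1 < p.2}, WilsonRP.plaqRe ρ U (x, q)) 2
        (wilsonMeasure (d := 4) (L := 2 * S + 1) ρ β) := fun x =>
    MemLp.of_bound (ThetaCorrRP.measurable_sdens ρ hρ x).aestronglyMeasurable _
      (ae_of_all _ fun U => by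
        rw [Real.norm_eq_abs]
        exact ThetaCorrRP.abs_sdens_le ρ hρ x U)
  have hLpθ : MemLp (fun U : GaugeConfig 4 (2 * S + 1) G =>
      ∑ q : {p : Fin 4 × Fin 4 // p.1 < p.2}, WilsonRP.plaqRe ρ (GaugeConfig.timeReflect U)
        ((Pi.single 0 (2 : ZMod (2 * S + 1)) : Site 4 (2 * S + 1)), q)) 2
        (wilsonMeasure (d := 4) (L := 2 * S + 1) ρ β) :=
    MemLp.of_bound ((ThetaCorrRP.measurable_sdens ρ hρ _).comp
        WilsonRP.measurable_timeReflect).aestronglyMeasurable _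
      (ae_of_all _ fun U => by
        rw [Real.norm_eq_abs]
        exact ThetaCorrRP.abs_sdens_le ρ hρ _ _)
  rw [covariance_eq_sub hLpθ (hLp _)]
  simp only [latticeConnectedCorr, Function.comp_apply, actionDensity_gaugeTimeReflect_torusLift,
    actionDensity_configShift_torusLift, actionDensity_torusLift_eq_sdens, Pi.mul_apply,
    integral_sdens_axis]

end Bridge

/-! ### The stub -/

variable {G : Type} [Group G] [TopologicalSpace G] [IsTopologicalGroup G] [CompactSpace G]
  [MeasurableSpace G] [BorelSpace G]

/-- **stub_thetaCorrRP** (torus input (T-Hankel): the two Hankel positivities of the odd torus): for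
every separation `n`, on all large odd tori the `Θ`-paired curvature correlator
`a_S(n) = ⟨(P∘Θ)·τₙP⟩ − ⟨P∘Θ⟩⟨P⟩` is non-negative and log-convex at `n` — reflection positivity of
Wilson's measure (`β ≥ 0`) for the mixed site/bond time reflection of the torus of side `2S+1`,
in Cauchy–Schwarz form, applied to the slab action densities `Q_s` (`1 ≤ s ≤ S`, even `n`) and to
the reflected ones `Q_{-s} ∘ Θ_T` (odd `n`, using the period `2S + 1 ≡ 0`); the bridge
`a_S(n) = Cov(Q_2 ∘ Θ_T, Q_n)` is `latticeConnectedCorr_theta`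
(Osterwalder–Seiler 1978 §2; Glimm–Jaffe 1987 §6.1). [folklore] -/
theorem stub_thetaCorrRP (r : LatticeRep G) {β : ℝ} (hβ : 0 ≤ β) (n : ℕ) :
    ∀ᶠ S : ℕ in atTop,
      0 ≤ latticeConnectedCorr r.ρ β (2 * S + 1) (r.curvature.F ∘ gaugeTimeReflect) r.curvature.F n ∧
      latticeConnectedCorr r.ρ β (2 * S + 1) (r.curvature.F ∘ gaugeTimeReflect) r.curvature.F (n + 1) ^ 2 ≤
        latticeConnectedCorr r.ρ β (2 * S + 1) (r.curvature.F ∘ gaugeTimeReflect) r.curvature.F n *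
          latticeConnectedCorr r.ρ β (2 * S + 1) (r.curvature.F ∘ gaugeTimeReflect) r.curvature.F
            (n + 2) := by
  refine Filter.eventually_atTop.2 ⟨n + 3, fun S hS => ?_⟩
  -- the reflected covariance of the slab action density along the time axis
  obtain ⟨c, hc⟩ : ∃ c : ZMod (2 * S + 1) → ZMod (2 * S + 1) → ℝ, ∀ a b : ZMod (2 * S + 1), c a b =
      ProbabilityTheory.covariance
        (fun U => ∑ q : {p : Fin 4 × Fin 4 // p.1 < p.2}, (r.ρ (plaquetteHolonomy (GaugeConfig.timeReflect U)
          (Pi.single 0 a : Literature.MathematicalPhysics.QuantumFieldTheory.Site 4 (2 * S + 1))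
            q.1.1 q.1.2)).trace.re)
        (fun U => ∑ q : {p : Fin 4 × Fin 4 // p.1 < p.2}, (r.ρ (plaquetteHolonomy U
          (Pi.single 0 b : Literature.MathematicalPhysics.QuantumFieldTheory.Site 4 (2 * S + 1))
            q.1.1 q.1.2)).trace.re)
        (wilsonMeasure (d := 4) (L := 2 * S + 1) r.ρ β) := ⟨_, fun _ _ => rfl⟩
  -- the curvature species is the action density (`LatticeRep.curvature`, by `rfl`)
  have hF : r.curvature.F = actionDensity r.ρ := rfl
  have ha : ∀ k : ℕ, latticeConnectedCorr r.ρ β (2 * S + 1) (r.curvature.F ∘ gaugeTimeReflect)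
      r.curvature.F k = c 2 k := fun k => by
    rw [hc, hF]
    exact latticeConnectedCorr_theta r.ρ r.continuous β S k
  obtain ⟨hshift, hpos, hneg⟩ :=
    stub_thetaCorrRP_torus G r.N r.ρ r.continuous β hβ S (by omega) c hc
  have hL0 : (2 : ZMod (2 * S + 1)) * (S : ZMod (2 * S + 1)) + 1 = 0 := by
    have h := ZMod.natCast_self (2 * S + 1)
    push_cast at h
    exact h
  simp only [ha]
  obtain ⟨i, rfl | rfl⟩ := Nat.even_or_odd' n
  · -- even separation `n = 2i`: the slabs `Q_{i+1}`, `Q_{i+2}`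
    obtain ⟨h0, hcs⟩ := hpos (i + 1) (i + 2) (by omega) (by omega) (by omega) (by omega)
    have e1 : c 2 ((2 * i : ℕ) : ZMod (2 * S + 1)) =
        c ((i + 1 : ℕ) : ZMod (2 * S + 1)) ((i + 1 : ℕ) : ZMod (2 * S + 1)) := by
      rw [hshift 2 _ ((i : ZMod (2 * S + 1)) - 1)]
      congr 1 <;> push_cast <;> ring
    have e2 : c 2 ((2 * i + 1 : ℕ) : ZMod (2 * S + 1)) =
        c ((i + 1 : ℕ) : ZMod (2 * S + 1)) ((i + 2 : ℕ) : ZMod (2 * S + 1)) := by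
      rw [hshift 2 _ ((i : ZMod (2 * S + 1)) - 1)]
      congr 1 <;> push_cast <;> ring
    have e3 : c 2 ((2 * i + 2 : ℕ) : ZMod (2 * S + 1)) =
        c ((i + 2 : ℕ) : ZMod (2 * S + 1)) ((i + 2 : ℕ) : ZMod (2 * S + 1)) := by
      rw [hshift 2 _ (i : ZMod (2 * S + 1))]
      congr 1 <;> push_cast <;> ring
    rw [e1, e2, e3]
    exact ⟨h0, hcs⟩
  · -- odd separation `n = 2i+1`: the reflected slabs `Q_{-(S-1-i)} ∘ Θ_T`, `Q_{-(S-2-i)} ∘ Θ_T`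
    obtain ⟨h0, hcs⟩ := hneg (S - 1 - i) (S - 2 - i) (by omega) (by omega) (by omega) (by omega)
    have hs : ((S - 1 - i : ℕ) : ZMod (2 * S + 1)) = (S : ZMod (2 * S + 1)) - 1 - i := by
      rw [Nat.cast_sub (by omega), Nat.cast_sub (by omega), Nat.cast_one]
    have hs' : ((S - 2 - i : ℕ) : ZMod (2 * S + 1)) = (S : ZMod (2 * S + 1)) - 2 - i := by
      rw [Nat.cast_sub (by omega), Nat.cast_sub (by omega), Nat.cast_ofNat]
    have e1 : c 2 ((2 * i + 1 : ℕ) : ZMod (2 * S + 1)) =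
        c (-((S - 1 - i : ℕ) : ZMod (2 * S + 1))) (-((S - 1 - i : ℕ) : ZMod (2 * S + 1))) := by
      rw [hshift 2 _ ((i : ZMod (2 * S + 1)) - 1 - S), hs]
      congr 1
      · ring
      · push_cast
        linear_combination hL0
    have e2 : c 2 ((2 * i + 1 + 1 : ℕ) : ZMod (2 * S + 1)) =
        c (-((S - 2 - i : ℕ) : ZMod (2 * S + 1))) (-((S - 1 - i : ℕ) : ZMod (2 * S + 1))) := by
      rw [hshift 2 _ ((i : ZMod (2 * S + 1)) - S), hs, hs']
      congr 1
      · ring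
      · push_cast
        linear_combination hL0
    have e3 : c 2 ((2 * i + 1 + 2 : ℕ) : ZMod (2 * S + 1)) =
        c (-((S - 2 - i : ℕ) : ZMod (2 * S + 1))) (-((S - 2 - i : ℕ) : ZMod (2 * S + 1))) := by
      rw [hshift 2 _ ((i : ZMod (2 * S + 1)) - S), hs']
      congr 1
      · ring
      · push_cast
        linear_combination hL0
    rw [e1, e2, e3]
    exact ⟨h0, hcs⟩

end Summit.QuantumFields.YangMills.Theorems.CriticalContinuumLimit

end
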